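import Mathlib

/-!
# TASK T-S5/U5.4a «Gaussian determinant formula» (`GaussianDeterminantFormula`), PROVED

Planner ym-idea-2 g17's typed task `Cruxes/BoxWindowHighSU2213/TaskS5Gauss.lean` (commit 4834d69c3190, sha12 eaaec7dd5833) — the
finite-dimensional Gaussian integral behind the Faddeev–Popov determinant in step (1b) (T-S5.4, Laplace asymptotics of the orbit average
`N_h`) of the XL comparison stubs S5 (LINE-19 ⟨stmt-QuantumFields-24004⟩/⟨24335⟩) and U5 (LINE-20 ⟨24336⟩).  The task's Prop
`GaussianDeterminantFormula` and its sanity lemma `gaussian_one_dim` are copied VERBATIM (a `Cruxes/` file is not importable from `Theorems/`).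

Proved here: **`gaussianDeterminantFormula : GaussianDeterminantFormula`** —
`∫_{ℝⁿ} exp(−β ‖M v‖²) dv = (√(π/β))ⁿ / |det M|` for an invertible real `n × n` matrix `M` and `β > 0`, over Lebesgue measure on `Fin n → ℝ`.
Proof (Mathlib only): the linear change of variables `w = M v`
(`Real.map_matrix_volume_pi_eq_smul_volume_pi`: `(toLin' M)_* vol = |det M|⁻¹ • vol`, read through `integral_map`), then
`exp(−β (w ⬝ᵥ w)) = ∏ᵢ exp(−β wᵢ²)` and Fubini in the form `integral_fintype_prod_volume_eq_pow`, and `integral_gaussian` in each variable.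
(The tree's anisotropic Gaussian `Literature.Analysis.Asymptotics.integral_exp_neg_half_inner_self` on an inner-product space gives the
same number with `A = 2β MᵀM`; the matrix form over the pi type is what T-S5.4 quotes, hence this direct proof.)

HONEST LABEL: an elementary analytic brick of step (1b) of the XL stubs S5/U5; T-S5.4 itself (the Laplace asymptotics of `N_h`) is NOT
touched; S5, U5, ⟨24004⟩ ⟨24335⟩ ⟨24336⟩ remain OPEN; no summit is proved; the Yang–Mills mass gap is NOT proved by this file.
Seat ym-line-sfw-p2-w5 g21 (cell ym-idea-1).
-/

set_option autoImplicit false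

noncomputable section

open MeasureTheory Matrix

namespace Summit.QuantumFields.YangMills.Theorems.AllWindowsColdBoxBoxHighLine

/-! ## The task's objects (verbatim from `TaskS5Gauss.lean`) -/

/-- T-S5.4a **(Gaussian determinant formula; S–M)**: for an invertible real `n × n` matrix `M` and `β > 0`,
`∫_{ℝⁿ} exp(−β ‖M v‖²) dv = (√(π/β))ⁿ / |det M|`. -/
def GaussianDeterminantFormula : Prop :=
  ∀ (n : ℕ) (M : Matrix (Fin n) (Fin n) ℝ), M.det ≠ 0 → ∀ β : ℝ, 0 < β →
    ∫ v : Fin n → ℝ, Real.exp (-(β * (M.mulVec v ⬝ᵥ M.mulVec v))) = Real.sqrt (Real.pi / β) ^ n / |M.det|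

/-- Sanity instance of the statement's normalisation (`n = 1`, `M = 1`): the classical Gaussian integral, from Mathlib. -/
theorem gaussian_one_dim (β : ℝ) : ∫ x : ℝ, Real.exp (-(β * x ^ 2)) = Real.sqrt (Real.pi / β) := by
  simpa [neg_mul] using integral_gaussian β

/-! ## Proof -/

/-- The isotropic Gaussian on `Fin n → ℝ` factorises: `∫ exp(−β (w ⬝ᵥ w)) dw = (√(π/β))ⁿ` (Fubini in the form `integral_fintype_prod_volume_eq_pow` + the one-dimensional `gaussian_one_dim`). -/
theorem integral_exp_neg_mul_dotProduct_self (n : ℕ) (β : ℝ) :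
    ∫ w : Fin n → ℝ, Real.exp (-(β * (w ⬝ᵥ w))) = Real.sqrt (Real.pi / β) ^ n := by
  have hfun : (fun w : Fin n → ℝ => Real.exp (-(β * (w ⬝ᵥ w)))) = fun w => ∏ i, Real.exp (-(β * (w i) ^ 2)) := by
    funext w
    rw [← Real.exp_sum]
    congr 1
    simp only [dotProduct, Finset.mul_sum, ← Finset.sum_neg_distrib, pow_two]
  rw [hfun, integral_fintype_prod_volume_eq_pow (fun t : ℝ => Real.exp (-(β * t ^ 2))), gaussian_one_dim, Fintype.card_fin]

/-- **T-S5.4a: the Gaussian determinant formula.** -/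
theorem gaussianDeterminantFormula : GaussianDeterminantFormula := by
  intro n M hM β _hβ
  set g : (Fin n → ℝ) → ℝ := fun w => Real.exp (-(β * (w ⬝ᵥ w))) with hg
  have hgc : Continuous g := by
    simp only [hg]
    fun_prop
  -- the integrand is `g ∘ toLin' M`
  have h1 : (fun v : Fin n → ℝ => Real.exp (-(β * (M.mulVec v ⬝ᵥ M.mulVec v)))) = fun v => g (Matrix.toLin' M v) := by
    funext v; simp only [hg, Matrix.toLin'_apply]
  rw [h1, ← integral_map (Matrix.toLin' M).continuous_of_finiteDimensional.aemeasurable hgc.aestronglyMeasurable,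
    Real.map_matrix_volume_pi_eq_smul_volume_pi hM, integral_smul_measure, integral_exp_neg_mul_dotProduct_self,
    ENNReal.toReal_ofReal (abs_nonneg _), abs_inv, smul_eq_mul, inv_mul_eq_div]

end Summit.QuantumFields.YangMills.Theorems.AllWindowsColdBoxBoxHighLine

end
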